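import Summits.BirchSwinnertonDyer.BirchSwinnertonDyer.Theorems.AdditiveKolyvaginRoadKolyvaginRelaxedStab
import HarnessLib

/-!
# Route `AdditiveKolyvaginRoad`, crux `LevelKolyvaginSystemsAdditive` (item stmt-BirchSwinnertonDyer-21396, KS′):
# (Stab) for the canonical structure relaxed at an ADMISSIBLE place (Gross 1991 (5.1)) — ingredient of (R)
# (cell `pub/bsd-wall`, lead prover `bsd-wall-akr-p2x` g0, line `birth`; `--supports stmt-BirchSwinnertonDyer-21396`, helper)

WHAT. `conjAct_mem_relaxedAt`: complex conjugation `c` preserves the conditions «Kummer at `∞`, Kummer at the finite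
places not above a given natural number `q₀` and above no prime of the level `n`, toric above the primes of `n`» on
`H¹(K, E[p])`. VERBATIM akr-p1 g4's `conjAct_mem_relaxedGroupP` (`AdditiveKolyvaginRoadKolyvaginRelaxedStab.lean`) with the
special Kolyvagin prime replaced by an arbitrary natural number (an admissible prime in the application: the sign
splitting of the Poitou–Tate jump at one relaxed admissible place, step 3 of R-ROADMAP on 21396) and no transverse places.

HONEST FRAMING: one theorem; 0 definitions, 0 named facts, 0 `sorry`; unconditional; closes nothing. BSD is not proved
by any of this.

References: [cite: GrossLMS1991, §5 (5.1)] [cite: BertoliniDarmon2005, §2.2–§2.3] [cite: WZhang2014, §8.1].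
-/

-- single-conjunct summit: `Summit.BirchSwinnertonDyer.BirchSwinnertonDyer.…` repeats the name by design
set_option linter.dupNamespace false

noncomputable section

open scoped Classical Pointwise
open NumberField IsDedekindDomain Field WeierstrassCurve
open Literature.NumberTheory.EllipticCurves Literature.NumberTheory.GaloisRepresentations
open Literature.NumberTheory.Automorphic
open Summit.BirchSwinnertonDyer.Rank1Residual.X11b
open Summit.BirchSwinnertonDyer.Rank1Residual.X11b.Three.Koly.ZhangSupply.LocalConj

namespace Summit.BirchSwinnertonDyer.BirchSwinnertonDyer.Theorems.AdditiveKoly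

variable (W : WeierstrassCurve ℚ) (K : Type) [Field K] [NumberField K] (p : ℕ) [W.IsGloballyMinimal]

/-! ## §1 Stability of the relaxed conditions under complex conjugation (Gross (5.1)) -/

/-- **(Stab) for the structure relaxed at an admissible place**: for `K` imaginary quadratic, `c ≠ 1`, a level `n` and a
natural number `q₀` (the special prime): if `x` is Kummer at `∞`, Kummer at the finite places not above `q₀` and above no
prime of `n`, and toric above the primes of `n` (not above `q₀`), then so is `c_* x`. VERBATIM akr-p1's
`conjAct_mem_relaxedGroupP` with the Kolyvagin prime replaced by `q₀` and no transverse places.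
[cite: GrossLMS1991, §5 (5.1)] [cite: BertoliniDarmon2005, §2.2–§2.3] -/
theorem conjAct_mem_relaxedAt (hK : IsImaginaryQuadratic K) (c : K ≃ₐ[ℚ] K) (n : Finset (AdmQ W K p)) (q₀ : ℕ)
    (x : Vp W K p)
    (hx : (∀ u : InfinitePlace K, x ∈ selmerLocalKer (W.baseChange K) u.Completion ((p ^ 1 : ℕ) : ℤ)) ∧
      (∀ v : HeightOneSpectrum (𝓞 K), (q₀ : 𝓞 K) ∉ v.asIdeal →
        ((∀ q ∈ n, ((q : ℕ) : 𝓞 K) ∉ v.asIdeal) →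
          x ∈ selmerLocalKer (W.baseChange K) (v.adicCompletion K) ((p ^ 1 : ℕ) : ℤ)) ∧
        (∀ q ∈ n, ((q : ℕ) : 𝓞 K) ∈ v.asIdeal →
          x ∈ toricLocalKer (W.baseChange K) (v.adicCompletion K) ((p ^ 1 : ℕ) : ℤ)))) :
    (∀ u : InfinitePlace K,
        conjAct W c ((p ^ 1 : ℕ) : ℤ) x ∈ selmerLocalKer (W.baseChange K) u.Completion ((p ^ 1 : ℕ) : ℤ)) ∧
      (∀ v : HeightOneSpectrum (𝓞 K), (q₀ : 𝓞 K) ∉ v.asIdeal →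
        ((∀ q ∈ n, ((q : ℕ) : 𝓞 K) ∉ v.asIdeal) →
          conjAct W c ((p ^ 1 : ℕ) : ℤ) x ∈ selmerLocalKer (W.baseChange K) (v.adicCompletion K) ((p ^ 1 : ℕ) : ℤ)) ∧
        (∀ q ∈ n, ((q : ℕ) : 𝓞 K) ∈ v.asIdeal →
          conjAct W c ((p ^ 1 : ℕ) : ℤ) x ∈ toricLocalKer (W.baseChange K) (v.adicCompletion K) ((p ^ 1 : ℕ) : ℤ))) := by
  haveI : IsTotallyComplex K := hK.2
  have hnat : ∀ (σ : K ≃ₐ[ℚ] K) (v : HeightOneSpectrum (𝓞 K)) (q : ℕ),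
      (q : 𝓞 K) ∈ (σ • v).asIdeal ↔ (q : 𝓞 K) ∈ v.asIdeal := by
    intro σ v q
    have hq : σ • (q : 𝓞 K) = (q : 𝓞 K) := map_natCast (MulSemiringAction.toRingHom (K ≃ₐ[ℚ] K) (𝓞 K) σ) q
    rw [← HeightOneSpectrum.smul_mem_smul_asIdeal_iff σ v (q : 𝓞 K), hq]
  refine ⟨fun u ↦ ?_, fun v hv ↦ ?_⟩
  · haveI : IsAlgClosed u.Completion :=
      isAlgClosed_of_ringEquiv (InfinitePlace.Completion.ringEquivComplexOfIsComplex (IsTotallyComplex.isComplex u)).symm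
    rw [WeierstrassCurve.selmerLocalKer_eq_top_of_isAlgClosed]
    trivial
  · have h0 : c • (c⁻¹ • v) = v := smul_inv_smul c v
    have hv₀ : (q₀ : 𝓞 K) ∉ (c⁻¹ • v).asIdeal := fun h ↦ hv ((hnat c⁻¹ v q₀).mp h)
    haveI : CharZero ((c⁻¹ • v).adicCompletion K) := charZero_of_injective_algebraMap (algebraMap K _).injective
    haveI : CharZero (v.adicCompletion K) := charZero_of_injective_algebraMap (algebraMap K _).injective
    obtain ⟨hk, ho⟩ := hx.2 (c⁻¹ • v) hv₀
    refine ⟨fun hq ↦ ?_, fun q hq hqv ↦ ?_⟩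
    · exact (conjAct_mem_selmerLocalKer_iff W c (galAdicCompletionEquiv (L := K) c h0)
        (isSemilinearRingEquiv_galAdicCompletionEquiv c h0) _ x).mpr
        (hk fun q hqn hqv ↦ hq q hqn ((hnat c⁻¹ v q).mp hqv))
    · exact (conjAct_mem_toricLocalKer_adicCompletion_iff W c h0 _ x).mpr
        (ho q hq ((hnat c⁻¹ v q).mpr hqv))

end Summit.BirchSwinnertonDyer.BirchSwinnertonDyer.Theorems.AdditiveKoly

end
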